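import Mathlib
import HarnessLib
import Literature.Analysis.FluidPDE.VorticityCalculus
import Literature.Analysis.FluidPDE.LocalTypeI
import Summits.NavierStokesRegularity.NavierStokesRegularity.Theorems.AxisTwistDoorAveragedConeLiouvilleDefs
import Summits.NavierStokesRegularity.NavierStokesRegularity.Theorems.AxisTwistDoorAveragedConeLiouvilleCircleStokes
import Summits.NavierStokesRegularity.NavierStokesRegularity.Theorems.AxisTwistDoorAveragedConeLiouvilleCylFrame
import Summits.NavierStokesRegularity.NavierStokesRegularity.Theorems.LocalSineTubeDoorProfileAlignedWindowRigidityAncient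
import Summits.NavierStokesRegularity.NavierStokesRegularity.Theorems.PoloidalWindowDoorPoloidalWindowRigidityFlat
import Summits.NavierStokesRegularity.NavierStokesRegularity.Theorems.PoloidalWindowDoorPoloidalWindowRigiditySymmetryGerms

/-!
# Route `AxisTwistDoor`, crux `AveragedConeLiouville` (stmt-NavierStokesRegularity-26889), line `lrt_shell` —
# brick R1 toward stub (6) `stub_regularOfFluxDecay`: VANISHING AXIS FLUX ON ONE SLICE KILLS THE PROFILE

A rigidity brick in the TREE's toolbox (identity theorem + class rigidity, no Biot–Savart, no ε-regularity): if a profile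
`v` of the route's energy class has, on ONE slice `s < 0`, non-negative vertical vorticity `ω₃ ≥ 0`, the circle cone
`∮_{S(r,z)}|ω_h| dl ≤ K ∮_{S(r,z)} ω₃ dl` on the circles of an apex window `0 < r < ρ`, `|z| < ρ`, and VANISHING AXIS
CIRCULATION `Γ(r,z,s) = circ v r z s = 0` on that window, then `v ≡ 0` (`eq_zero_of_circ_eq_zero`), hence the apex is
not a backward singular point (`not_backwardSingular_of_circ_eq_zero`):

* `∂ᵣΓ = ∮ω₃ dl` (`…CircleStokes.deriv_circ_eq_vortCirc`) gives `∮_{S(r,z)} ω₃ r dθ = 0`; with `ω₃ ≥ 0` and continuity,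
  `ω₃ = 0` on every circle of the window (`eq_zero_of_integral_eq_zero_of_nonneg`);
* the cone then gives `∮|ω_h| r dθ ≤ 0`, so `ω_h = 0` on those circles: `curl v(s) = 0` on the open solid half-window
  `{y : y₁ > 0, y₀² + y₁² < ρ², |y₂| < ρ}` (polar representation `exists_cylPt_eq`);
* an irrotational germ on one slice kills a class profile
  (`…PoloidalWindowRigiditySymmetryGerms.eq_zero_of_curl_eq_zero_on_open`: identity theorem for the real-analytic
  slice, then the translation-invariant stratum), and the zero profile is backward regular
  (`…PoloidalWindowRigidityFlat.not_backwardSingular_of_zero`).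

With `SignE3 v` and `GlobalCone v` (crux vocabulary) this is `eq_zero_of_signE3_globalCone_circ_eq_zero`.  Intended use
(census of stub (6), evidence on the crux item): a SECOND ZOOM of a class profile under `FluxDecay` (class `C¹_loc`
compactness `exists_tendsto_of_isTypeIAncientMild_seq` + persistence of singularities) produces a class profile, singular
at the apex, with sign, cone and `Γ ≡ 0` on the unit window — which this brick forbids.

WHAT THIS IS NOT: a rigidity lemma about HYPOTHETICAL blow-up profiles of the route's class; nothing about Navier–Stokes
regularity (Clay A) is proved or claimed; `--supports` stmt-…-26889 only, no item is closed.
-/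

noncomputable section

-- the summit and its single sub-problem share the name (CONVENTIONS §1), as in every Theorems file
set_option linter.dupNamespace false

namespace Summit.NavierStokesRegularity.NavierStokesRegularity.Theorems.AveragedConeLiouville.FlatFlux

open scoped Topology InnerProductSpace
open Set Function MeasureTheory intervalIntegral Filter Metric
open Literature.Analysis
open Literature.Analysis.FluidPDE hiding eR
open Summit.NavierStokesRegularity.NavierStokesRegularity.Theorems.AxisTwistDoorAveragedConeLiouvilleDefs
open Summit.NavierStokesRegularity.NavierStokesRegularity.Theorems.AveragedConeLiouville.CircleStokes
open Summit.NavierStokesRegularity.NavierStokesRegularity.Theorems.AxisTwistDoorAveragedConeLiouvilleCylFrame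
open Summit.NavierStokesRegularity.NavierStokesRegularity.Theorems.LocalSineTubeDoorProfileAlignedWindowRigidityAncient
  (analyticOnNhd_slice bdd_of_hasTypeITimeDecay)
open Summit.NavierStokesRegularity.NavierStokesRegularity.Theorems.PoloidalWindowDoorPoloidalWindowRigidityFlat
  (not_backwardSingular_of_zero)
open Summit.NavierStokesRegularity.NavierStokesRegularity.Theorems.PoloidalWindowDoorPoloidalWindowRigiditySymmetryGerms
  (eq_zero_of_curl_eq_zero_on_open)

/-! ### Two elementary tools -/

/-- A continuous non-negative function with zero integral over `[0, 2π]` vanishes on `(0, 2π)`. -/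
theorem eq_zero_of_integral_eq_zero_of_nonneg {g : ℝ → ℝ} (hg : Continuous g) (h0 : ∀ θ, 0 ≤ g θ)
    (hint : ∫ θ in (0 : ℝ)..(2 * Real.pi), g θ = 0) {θ : ℝ} (hθ : θ ∈ Ioo (0 : ℝ) (2 * Real.pi)) :
    g θ = 0 := by
  have hae : g =ᵐ[volume.restrict (Ioc (0 : ℝ) (2 * Real.pi))] 0 :=
    (intervalIntegral.integral_eq_zero_iff_of_le_of_nonneg_ae (by positivity)
      (Eventually.of_forall fun θ => h0 θ) (hg.intervalIntegrable _ _)).1 hint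
  have hae' : g =ᵐ[volume.restrict (Ioo (0 : ℝ) (2 * Real.pi))] fun _ => (0 : ℝ) :=
    ae_restrict_of_ae_restrict_of_subset Ioo_subset_Ioc_self hae
  exact Measure.eqOn_open_of_ae_eq hae' isOpen_Ioo hg.continuousOn continuousOn_const hθ

/-- Polar representation off the half-plane `{y₁ ≤ 0}`: a point with `y₁ > 0` is `cylPt r θ (y 2)` with
`r = ‖(y₀, y₁)‖ > 0`, `r² = y₀² + y₁²` and an angle `θ ∈ (0, 2π)`. -/
theorem exists_cylPt_eq {y : EuclideanSpace ℝ (Fin 3)} (hy : 0 < y 1) :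
    ∃ r θ : ℝ, 0 < r ∧ r ^ 2 = y 0 ^ 2 + y 1 ^ 2 ∧ θ ∈ Ioo (0 : ℝ) (2 * Real.pi) ∧ cylPt r θ (y 2) = y := by
  obtain ⟨w, hw⟩ : ∃ w : ℂ, w = ⟨y 0, y 1⟩ := ⟨_, rfl⟩
  have hre : w.re = y 0 := by rw [hw]
  have him : w.im = y 1 := by rw [hw]
  have hw0 : w ≠ 0 := fun h => by
    have : w.im = 0 := by rw [h]; rfl
    linarith [him.symm.trans this]
  refine ⟨‖w‖, Complex.arg w, norm_pos_iff.2 hw0, ?_, ⟨?_, ?_⟩, ?_⟩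
  · rw [Complex.sq_norm, Complex.normSq_apply, hre, him]; ring
  · have h1 : 0 ≤ Complex.arg w := Complex.arg_nonneg_iff.2 (by rw [him]; exact hy.le)
    have h2 : Complex.arg w ≠ 0 := fun h => by
      have := (Complex.arg_eq_zero_iff.1 h).2
      linarith [him.symm.trans this]
    exact lt_of_le_of_ne h1 (Ne.symm h2)
  · linarith [Complex.arg_le_pi w, Real.pi_pos]
  · have hc : ‖w‖ * Real.cos (Complex.arg w) = y 0 := by rw [Complex.norm_mul_cos_arg, hre]
    have hs : ‖w‖ * Real.sin (Complex.arg w) = y 1 := by rw [Complex.norm_mul_sin_arg, him]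
    ext i
    fin_cases i
    · simpa [cylPt] using hc
    · simpa [cylPt] using hs
    · simp [cylPt]

/-- The open solid half-window `{y : y₁ > 0, y₀² + y₁² < ρ², |y₂| < ρ}` about the axis. -/
theorem isOpen_halfWindow (ρ : ℝ) :
    IsOpen {y : EuclideanSpace ℝ (Fin 3) | 0 < y 1 ∧ y 0 ^ 2 + y 1 ^ 2 < ρ ^ 2 ∧ |y 2| < ρ} := by
  have hc : ∀ i : Fin 3, Continuous fun y : EuclideanSpace ℝ (Fin 3) => y i := fun i =>
    (EuclideanSpace.proj i).continuous
  exact (isOpen_lt continuous_const (hc 1)).inter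
    ((isOpen_lt (((hc 0).pow 2).add ((hc 1).pow 2)) continuous_const).inter
      (isOpen_lt ((hc 2).abs) continuous_const))

/-- The half-window is non-empty for `ρ > 0` (it contains `(0, ρ/2, 0)`). -/
theorem halfWindow_nonempty {ρ : ℝ} (hρ : 0 < ρ) :
    ({y : EuclideanSpace ℝ (Fin 3) | 0 < y 1 ∧ y 0 ^ 2 + y 1 ^ 2 < ρ ^ 2 ∧ |y 2| < ρ}).Nonempty := by
  refine ⟨WithLp.toLp 2 ![0, ρ / 2, 0], ?_, ?_, ?_⟩
  · simp; positivity
  · simp; nlinarith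
  · simp; positivity

/-! ### The rigidity brick -/

variable {C : ℝ} {v : ℝ → EuclideanSpace ℝ (Fin 3) → EuclideanSpace ℝ (Fin 3)}

/-- **On a circle of the window the vorticity vanishes.**  Slice `s < 0` with `C¹` velocity, `ω₃ ≥ 0` on the slice,
the circle cone with constant `K` at `(r, z)`, and `Γ(·, z, s) = 0` near `r`: then `curl v(s) = 0` at every point
`cylPt r θ z`, `θ ∈ (0, 2π)`. -/
theorem curl_eq_zero_on_circle {s : ℝ} (hv : ContDiff ℝ 1 (v s))
    (hsign : ∀ y, 0 ≤ ⟪curl (v s) y, e3⟫_ℝ) {K r z : ℝ} (hr : 0 < r)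
    (hcone : tiltCirc v r z s ≤ K * vortCirc v r z s)
    (hcirc : (fun r' => circ v r' z s) =ᶠ[𝓝 r] fun _ => 0) {θ : ℝ} (hθ : θ ∈ Ioo (0 : ℝ) (2 * Real.pi)) :
    curl (v s) (cylPt r θ z) = 0 := by
  -- `∮ ω₃ r dθ = ∂ᵣΓ = 0`
  have hvort : vortCirc v r z s = 0 := by
    rw [← deriv_circ_eq_vortCirc v hv r z, hcirc.deriv_eq, deriv_const]
  have hp := continuous_cylPt_θ r z
  have hωc : Continuous fun θ => curl (v s) (cylPt r θ z) := (continuous_curl hv).comp hp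
  -- `ω₃ = 0` on the circle
  have h3 : ∀ θ ∈ Ioo (0 : ℝ) (2 * Real.pi), ⟪curl (v s) (cylPt r θ z), e3⟫_ℝ = 0 := by
    intro θ' hθ'
    have hfc : Continuous fun θ => ⟪curl (v s) (cylPt r θ z), e3⟫_ℝ * r :=
      Continuous.mul (Continuous.inner hωc continuous_const) continuous_const
    have hint : ∫ θ in (0 : ℝ)..(2 * Real.pi), ⟪curl (v s) (cylPt r θ z), e3⟫_ℝ * r = 0 := by
      unfold vortCirc at hvort
      exact hvort
    have h := eq_zero_of_integral_eq_zero_of_nonneg hfc (fun θ => mul_nonneg (hsign _) hr.le) hint hθ'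
    exact (mul_eq_zero.1 h).resolve_right hr.ne'
  -- `ω_h = 0` on the circle, by the cone
  have htilt0 : tiltCirc v r z s = 0 := by
    have hle : tiltCirc v r z s ≤ 0 := by rw [hvort, mul_zero] at hcone; exact hcone
    have hge : 0 ≤ tiltCirc v r z s := by
      unfold tiltCirc
      exact intervalIntegral.integral_nonneg (by positivity) fun θ _ => mul_nonneg (norm_nonneg _) hr.le
    exact le_antisymm hle hge
  have hh : ∀ θ ∈ Ioo (0 : ℝ) (2 * Real.pi),
      curl (v s) (cylPt r θ z) - ⟪curl (v s) (cylPt r θ z), e3⟫_ℝ • e3 = 0 := by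
    intro θ' hθ'
    have hic : Continuous fun θ => ⟪curl (v s) (cylPt r θ z), e3⟫_ℝ := Continuous.inner hωc continuous_const
    have h3c : Continuous fun θ => ⟪curl (v s) (cylPt r θ z), e3⟫_ℝ • e3 := by fun_prop
    have hdc : Continuous fun θ => curl (v s) (cylPt r θ z) - ⟪curl (v s) (cylPt r θ z), e3⟫_ℝ • e3 :=
      Continuous.sub hωc h3c
    have hgc : Continuous fun θ => ‖curl (v s) (cylPt r θ z) - ⟪curl (v s) (cylPt r θ z), e3⟫_ℝ • e3‖ * r :=
      Continuous.mul (Continuous.norm hdc) continuous_const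
    have hint : ∫ θ in (0 : ℝ)..(2 * Real.pi),
        ‖curl (v s) (cylPt r θ z) - ⟪curl (v s) (cylPt r θ z), e3⟫_ℝ • e3‖ * r = 0 := by
      unfold tiltCirc at htilt0
      exact htilt0
    have h := eq_zero_of_integral_eq_zero_of_nonneg hgc (fun θ => mul_nonneg (norm_nonneg _) hr.le) hint hθ'
    exact norm_eq_zero.1 ((mul_eq_zero.1 h).resolve_right hr.ne')
  have h := hh θ hθ
  rwa [h3 θ hθ, zero_smul, sub_zero] at h

/-- **VANISHING AXIS FLUX ON ONE SLICE KILLS THE PROFILE.**  A profile of the route's energy class (Type-I rate,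
continuity on the open slab, unit-viscosity Oseen–Duhamel identity, divergence-free slices) with, on one slice `s < 0`,
`ω₃ ≥ 0`, the circle cone `∮|ω_h| ≤ K ∮ω₃` on the window `0 < r < ρ`, `|z| < ρ`, and `Γ = 0` there, vanishes identically. -/
theorem eq_zero_of_circ_eq_zero (hrate : HasTypeITimeDecay C v)
    (hcont : ContinuousOn (uncurry v) (Iio (0 : ℝ) ×ˢ univ))
    (hmild : ∀ s t : ℝ, s < t → t < 0 → ∀ x,
      v t x = UnboundedOperators.heatExtension (v s) (t - s) x - oseenDuhamel 1 s v v t x)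
    (hdiv : ∀ t < 0, VectorCalculus.IsDivFree (v t)) {s : ℝ} (hs : s < 0)
    (hsign : ∀ y, 0 ≤ ⟪curl (v s) y, e3⟫_ℝ) {K ρ : ℝ} (hρ : 0 < ρ)
    (hcone : ∀ r : ℝ, 0 < r → r < ρ → ∀ z ∈ Ioo (-ρ) ρ, tiltCirc v r z s ≤ K * vortCirc v r z s)
    (hcirc : ∀ r ∈ Ioo (0 : ℝ) ρ, ∀ z ∈ Ioo (-ρ) ρ, circ v r z s = 0) :
    ∀ t < 0, ∀ x, v t x = 0 := by
  have hA := analyticOnNhd_slice hcont (bdd_of_hasTypeITimeDecay hrate) hmild hs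
  have hv : ContDiff ℝ 1 (v s) := hA.contDiff
  refine eq_zero_of_curl_eq_zero_on_open hrate hcont hmild hdiv hs (isOpen_halfWindow ρ) (halfWindow_nonempty hρ)
    fun y hy => ?_
  obtain ⟨hy1, hy01, hy2⟩ := hy
  obtain ⟨r, θ, hr, hr2, hθ, hyeq⟩ := exists_cylPt_eq hy1
  have hrρ : r < ρ := by
    have : r ^ 2 < ρ ^ 2 := by rw [hr2]; exact hy01
    exact lt_of_pow_lt_pow_left₀ 2 hρ.le this
  have hz : y 2 ∈ Ioo (-ρ) ρ := abs_lt.1 hy2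
  rw [← hyeq]
  refine curl_eq_zero_on_circle hv hsign hr (hcone r hr hrρ (y 2) hz) ?_ hθ
  filter_upwards [isOpen_Ioo.mem_nhds (show r ∈ Ioo (0 : ℝ) ρ from ⟨hr, hrρ⟩)] with r' hr'
  exact hcirc r' hr' (y 2) hz

/-- Corollary: such a profile is backward regular at the apex. -/
theorem not_backwardSingular_of_circ_eq_zero (hrate : HasTypeITimeDecay C v)
    (hcont : ContinuousOn (uncurry v) (Iio (0 : ℝ) ×ˢ univ))
    (hmild : ∀ s t : ℝ, s < t → t < 0 → ∀ x,
      v t x = UnboundedOperators.heatExtension (v s) (t - s) x - oseenDuhamel 1 s v v t x)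
    (hdiv : ∀ t < 0, VectorCalculus.IsDivFree (v t)) {s : ℝ} (hs : s < 0)
    (hsign : ∀ y, 0 ≤ ⟪curl (v s) y, e3⟫_ℝ) {K ρ : ℝ} (hρ : 0 < ρ)
    (hcone : ∀ r : ℝ, 0 < r → r < ρ → ∀ z ∈ Ioo (-ρ) ρ, tiltCirc v r z s ≤ K * vortCirc v r z s)
    (hcirc : ∀ r ∈ Ioo (0 : ℝ) ρ, ∀ z ∈ Ioo (-ρ) ρ, circ v r z s = 0) :
    ¬ IsBackwardSingularPoint v 0 :=
  not_backwardSingular_of_zero (eq_zero_of_circ_eq_zero hrate hcont hmild hdiv hs hsign hρ hcone hcirc)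

/-- **In the crux vocabulary**: a class profile with `SignE3`, `GlobalCone` and vanishing axis circulation on the apex
window of ONE slice `s < 0` vanishes identically (and so is backward regular at the apex). -/
theorem eq_zero_of_signE3_globalCone_circ_eq_zero (hrate : HasTypeITimeDecay C v)
    (hcont : ContinuousOn (uncurry v) (Iio (0 : ℝ) ×ˢ univ))
    (hmild : ∀ s t : ℝ, s < t → t < 0 → ∀ x,
      v t x = UnboundedOperators.heatExtension (v s) (t - s) x - oseenDuhamel 1 s v v t x)
    (hdiv : ∀ t < 0, VectorCalculus.IsDivFree (v t)) (hsign : SignE3 v) (hcone : GlobalCone v)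
    {s : ℝ} (hs : s < 0) {ρ : ℝ} (hρ : 0 < ρ)
    (hcirc : ∀ r ∈ Ioo (0 : ℝ) ρ, ∀ z ∈ Ioo (-ρ) ρ, circ v r z s = 0) :
    ∀ t < 0, ∀ x, v t x = 0 := by
  obtain ⟨K, -, hK⟩ := hcone
  exact eq_zero_of_circ_eq_zero hrate hcont hmild hdiv hs (fun y => hsign s hs y) hρ
    (fun r hr _ z _ => hK s hs r hr z) hcirc

/-- … and is backward regular at the apex. -/
theorem not_backwardSingular_of_signE3_globalCone_circ_eq_zero (hrate : HasTypeITimeDecay C v)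
    (hcont : ContinuousOn (uncurry v) (Iio (0 : ℝ) ×ˢ univ))
    (hmild : ∀ s t : ℝ, s < t → t < 0 → ∀ x,
      v t x = UnboundedOperators.heatExtension (v s) (t - s) x - oseenDuhamel 1 s v v t x)
    (hdiv : ∀ t < 0, VectorCalculus.IsDivFree (v t)) (hsign : SignE3 v) (hcone : GlobalCone v)
    {s : ℝ} (hs : s < 0) {ρ : ℝ} (hρ : 0 < ρ)
    (hcirc : ∀ r ∈ Ioo (0 : ℝ) ρ, ∀ z ∈ Ioo (-ρ) ρ, circ v r z s = 0) :
    ¬ IsBackwardSingularPoint v 0 :=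
  not_backwardSingular_of_zero
    (eq_zero_of_signE3_globalCone_circ_eq_zero hrate hcont hmild hdiv hsign hcone hs hρ hcirc)

end Summit.NavierStokesRegularity.NavierStokesRegularity.Theorems.AveragedConeLiouville.FlatFlux

end
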